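import Summits.FinalStateConjecture.FinalStateConjecture.Theorems.BartnikGapSettlingBondiBartnikRigiditySlabCauchyRigidityLensCauchy
import Summits.FinalStateConjecture.FinalStateConjecture.Theorems.BartnikGapSettlingBondiBartnikRigiditySlabCauchyRigidityLensConnected
import Summits.FinalStateConjecture.FinalStateConjecture.Theorems.BartnikGapSettlingBondiBartnikRigiditySlabCauchyRigidityPlacement
import Summits.FinalStateConjecture.FinalStateConjecture.Theorems.BartnikGapSettlingBondiBartnikRigiditySlabCauchyRigidityLocalisation
import Summits.FinalStateConjecture.FinalStateConjecture.Theorems.BartnikGapSettlingBondiBartnikRigiditySlabCauchyRigidityFactorisation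
import Summits.FinalStateConjecture.FinalStateConjecture.Theorems.BartnikGapSettlingBondiBartnikRigiditySlabCauchyRigidityMetricIdentity
import Summits.FinalStateConjecture.FinalStateConjecture.Theorems.BartnikGapSettlingBondiBartnikRigiditySlabCauchyRigiditySecondForm
import HarnessLib

/-!
# F1' `stub_slabCauchyRigidity'` — the corrected slab-jet Cauchy rigidity, proved modulo the MGHD
# existence fact: the checked reduction and the closer — line `direct-method-on-the-cone`, crux
# `BondiBartnikRigidity` (stmt-FinalStateConjecture-10807); module 10 (last) of the landing of the
# conditional proof of F1'

F1' (`F1Route.SlabCauchyRigidity'`, `…SlabCauchyRigidityDefs.lean`) says: in a maximal vacuum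
development `𝒱` of arbitrary data carrying ONE exact, future-oriented thick Kerr collar chart `Φ 0`
on the slab `{t* = 0, M < r ≤ 3M}`, there is an exact chart `Ψ` of the collar background on the
corrected diamond `Δ' = slabDiamond' = {0 < t*, 3t* + 2r < 6M}`, agreeing with `Φ 0` on the slab, a
smooth open embedding into the interior of the Killing domain, with deviation `0`.

* `slabCauchyRigidity'_of_route` — **the checked reduction** F1' ⟸ (A) `SlabSubdatum` ∧
  (C) `KerrSlabLensCauchy` ∧ (D) `SubdataDevelopmentsEmbedLit` ∧ (E) `SubdevelopmentFuturePlacement`: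
  the Kerr slab data `(ψ_N, ν_N)` on the open slab `N` restricted to the lens `V_K` is a vacuum Cauchy
  development `𝒦` of the sub-datum `Φ_N^* D` (by (A) and (C)); by (D) it embeds into the maximal `𝒱`
  over `Φ_N` by some `χ`; `Ψ = χ ∘ Λ⁻¹(· − c)` on the pulled-back lens is the exact chart, agrees with
  `Φ 0` on the slab (`χ ∘ ι_𝒦 = ι ∘ Φ_N`), and maps `Δ'` into `D⁺(collar core) ⊆` Killing domain by (E);
* `kerrSlabLensCauchy_holds` — (C) from modules 1–2; `slabSubdatum_holds` — (A) from (A1)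
  (`slabFactorisation_holds`, module 5), (A2h) (`slabMetricIdentity_holds`, module 6) and (A2k)
  (`slabSecondFormIdentity_holds`, module 9); (D) is module 4 (conditional on
  `choquetBruhat_geroch_exists_mghd_cauchy`), (E) module 3;
* `stub_slabCauchyRigidity'` — **the registered stub of the line**:
  `choquetBruhat_geroch_exists_mghd_cauchy → F1Route.SlabCauchyRigidity'`.

References: O'Neill 1983, Ch. 14 [ONeill1983]; Hawking–Ellis 1973, §7.6 [HawkingEllis1973CUP];
Choquet-Bruhat–Geroch 1969, Thm. 3 [ChoquetBruhatGeroch1969CMP].  No definitions; the MGHD existence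
fact stays a hypothesis (conditional by design).
-/

noncomputable section

-- D-0017: single-problem summit, `Summit.<S>.<S>.…` by design (cf. lakefile `weak.linter.dupNamespace`).
set_option linter.dupNamespace false
set_option maxSynthPendingDepth 3

open Set Filter Function Topology TopologicalSpace Bundle
open Literature.Geometry.Lorentzian
open scoped Manifold ContDiff Topology ENNReal

namespace Summit.FinalStateConjecture.FinalStateConjecture.Theorems.BondiBartnikRigidity.DirectMethod

namespace F1Route

/-! ### (C) and (A) assembled -/

/-- **(C) holds** — `kerrSlabLensCauchy_holds : KerrSlabLensCauchy` (modules 1–2). [folklore] -/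
theorem kerrSlabLensCauchy_holds : KerrSlabLensCauchy := fun M a hM ha =>
  ⟨isConnected_slabW (M := M) a hM, isConnected_lensK a hM, isCauchyHypersurface_slabKo hM ha,
    diamondK_subset_chronologicalFuture hM ha⟩

/-- **(A) holds** — `slabSubdatum_holds : SlabSubdatum`: the factorisation (A1), the metric identity
(A2h) and the second-form identity (A2k) (modules 5, 6, 9). [folklore] -/
theorem slabSubdatum_holds : SlabSubdatum := by
  intro _ _ k' hk' X _ _ _ _ _ _ D 𝒱 M a mo B Φ₀ hM ha hB hΦ hdev hslab hor
  obtain ⟨ΦN, hΦN, hΦN', hΦNo, hιΦ⟩ :=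
    slabFactorisation_holds k' X D 𝒱 M a mo B Φ₀ hM ha hB hΦ hdev hslab
  exact ⟨ΦN, hΦN, hΦN', hΦNo, hιΦ,
    slabMetricIdentity_holds k' X D 𝒱 M a mo B Φ₀ ΦN hM ha hB hΦ hdev hslab hΦN hιΦ,
    fun y v w => slabSecondFormIdentity_holds k' hk' X D 𝒱 M a mo B Φ₀ ΦN hM ha hB hΦ hdev hslab hor
      hΦN hιΦ y v w⟩

/-! ### The checked reduction `F1' ⟸ (A) ∧ (C) ∧ (D) ∧ (E)` -/

set_option maxHeartbeats 1600000 in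
/-- **F1' from the route**: the corrected slab-jet Cauchy rigidity follows from the Kerr
sub-datum identification (A), the Kerr slab-lens Cauchy property (C), the localisation principle
(D) and the placement lemma (E).  Pure plumbing (the Kerr chart facts are discharged).
[cite: ONeill1983, Ch. 14, Def. 14.35 ff.] -/
theorem slabCauchyRigidity'_of_route (hA : SlabSubdatum) (hC : KerrSlabLensCauchy)
    (hD : SubdataDevelopmentsEmbedLit) (hE : SubdevelopmentFuturePlacement) : SlabCauchyRigidity' := by
  haveI : Kerr.Facts :=
    ⟨Kerr.isConnected_region_holds, Kerr.contMDiff_bilin_holds, Kerr.contMDiff_timeVector_holds⟩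
  haveI : Kerr.SliceFacts := Kerr.sliceFacts_holds
  intro k' hk' X _ _ _ _ _ _ D 𝒱 M a p mo B Φ hmax hpar hp hB hΦ hdev hCX hor
  have hM : 0 < M 0 := (hpar 0).1
  have ha : |a 0| < M 0 := (hpar 0).2
  have hslab : Φ 0 '' (B 0).truncTimeSlab (3 * M 0) 0 ⊆ range 𝒱.embed :=
    (image_truncTimeSlab_subset_collarCore M p B Φ 0).trans hCX
  -- (A): the Kerr sub-datum
  obtain ⟨ΦN, hΦN, hΦN', hΦNo, hιΦ, hh, hk⟩ :=
    hA k' hk' X D 𝒱 (M 0) (a 0) (mo 0) (B 0) (Φ 0) hM ha (hB 0) (hΦ 0) (hdev 0) hslab (hor 0)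
  -- (C): the Kerr slab lens
  obtain ⟨hNconn, hLconn, hCauchy, hI⟩ := hC (M 0) (a 0) hM ha
  haveI : ConnectedSpace (slabW (M 0) (a 0)) := isConnected_iff_connectedSpace.mp hNconn
  -- the Kerr-side data embedding of the sub-datum `Φ_N^* D`
  set Dₑ : InitialDataSet (𝓡 3) (slabW (M 0) (a 0)) := D.comap ΦN hΦN hΦN' with hDₑ
  have hψemb : Manifold.IsSmoothEmbedding 𝓘(ℝ, E3) 𝓘(ℝ, E4) ∞ (ψN (M 0) (a 0)) :=
    isSmoothEmbedding_comp_subtypeVal (Kerr.isSmoothEmbedding_sliceEmbed_holds (a 0) (M 0))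
  have hνN : (Kerr.smoothMetric (M 0) (a 0) (M 0)).IsFutureUnitNormal 𝓘(ℝ, E3)
      ((Kerr.timeOrientation (M 0) (a 0) (M 0) hM.le).ofLE le_top) (ψN (M 0) (a 0)) (νN (M 0) (a 0)) := by
    obtain ⟨hu, hf⟩ := Kerr.isFutureUnitNormal_sliceNormal_holds (M 0) (a 0) (M 0) hM.le
    refine ⟨hu.comp_subtypeVal fun y => ?_, fun y => hf y.1⟩
    exact ((Kerr.isSmoothEmbedding_sliceEmbed_holds (a 0) (M 0)).contMDiff y).mdifferentiableAt
      (by simp)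
  let 𝒮K : DataEmbedding Dₑ :=
    { toSpacetime := Kerr.spacetime (M 0) (a 0) (M 0) hM.le
      embed := ψN (M 0) (a 0)
      isSmoothEmbedding := hψemb
      normal := νN (M 0) (a 0)
      isFutureUnitNormal := hνN
      induced_h := fun y ↦ by
        ext v w
        exact (hh y v w).symm
      induced_k := by
        intro instLC y
        haveI : (Kerr.smoothMetric (M 0) (a 0) (M 0)).HasLeviCivita := instLC
        ext v w
        exact (hk y v w).symm }
  have hvac : 𝒮K.IsVacuum := by
    intro instLC x
    haveI : (Kerr.metric (M 0) (a 0) (M 0)).HasLeviCivita := instLC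
    exact Kerr.ricci_smoothMetric (M 0) (a 0) (M 0) x
  -- restriction to the lens: a vacuum Cauchy development of the sub-datum
  set L : Opens (Kerr.region (a 0) (M 0)) := ⟨lensK (M 0) (a 0), isOpen_lensK (M 0) (a 0)⟩ with hL
  have hιL : ∀ y, 𝒮K.embed y ∈ L := fun y => slabKo_subset_lensK (ψN_mem_slabKo (M 0) (a 0) y)
  have hrange : range (𝒮K.embedOpens L hιL) = Subtype.val ⁻¹' slabKo (M 0) (a 0) := by
    ext z
    rw [← range_ψN_eq]
    constructor
    · rintro ⟨y, rfl⟩; exact ⟨y, rfl⟩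
    · rintro ⟨y, hy⟩; exact ⟨y, Subtype.ext hy⟩
  let 𝒦 : VacuumCauchyDevelopment Dₑ :=
    { toDataEmbedding := 𝒮K.restrict L hLconn hιL 𝒮K.mdifferentiableAt_embed_normal
      isCauchyHypersurface := by
        show ((𝒮K.metric.restrict PseudoRiemannianMetric.contMDiff_restrict_holds L).IsCauchyHypersurface
          (𝒮K.timeOrientation.restrict PseudoRiemannianMetric.contMDiff_restrict_holds
            𝒮K.timeOrientation.contMDiff_restrict_holds L) (range (𝒮K.embedOpens L hιL)))
        rw [hrange]
        exact hCauchy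
      isRicciFlat := by
        intro instLC
        haveI : (𝒮K.metric.restrict PseudoRiemannianMetric.contMDiff_restrict_holds
            L).toPseudoRiemannianMetric.HasLeviCivita := instLC
        exact 𝒮K.isRicciFlat_restrict L hvac }
  -- (D): the lens development embeds into the maximal development over `Φ_N`
  obtain ⟨χ, hχs, hχo, hχi, hχt, hχe⟩ := hD X D 𝒱 hmax (slabW (M 0) (a 0)) ΦN hΦN hΦN' hΦNo 𝒦
  -- (E): placement of the chronological future of the slab
  have hplace := hE (slabW (M 0) (a 0)) Dₑ 𝒦.toCauchyDevelopment 𝒱.toSpacetime χ hχs hχo hχi hχt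
  /- ### the rest-frame map `P = Λ⁻¹(· − c)` from the background domain onto the Kerr chart -/
  set P : E4 → E4 := poincareInv (mo 0).1 (mo 0).2 with hP
  have hdom : ((B 0).domain : Set E4) = P ⁻¹' (Kerr.region (a 0) (M 0) : Set E4) := by
    rw [hB 0]; rfl
  have htime : (B 0).time = fun x => P x 0 := by rw [hB 0]; rfl
  have hrad : (B 0).radius = fun x => Kerr.radius (a 0) (P x) := by rw [hB 0]; rfl
  have hbil : (B 0).bilin = boostedKerrBilin (mo 0).1 (mo 0).2 (M 0) (a 0) := by rw [hB 0]; rfl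
  have hPreg : ∀ x : (B 0).domain, P x.1 ∈ Kerr.region (a 0) (M 0) := fun x => by
    have hx : (x.1 : E4) ∈ ((B 0).domain : Set E4) := x.2
    rw [hdom] at hx
    exact hx
  set Pr : (B 0).domain → Kerr.region (a 0) (M 0) := fun x => ⟨P x.1, hPreg x⟩ with hPr
  have hPrs : ContMDiff 𝓘(ℝ, E4) 𝓘(ℝ, E4) ∞ Pr := by
    rw [← ContMDiff.subtypeVal_comp_iff]
    intro x
    exact contMDiffAt_subtype_iff.2 (KerrSchildChart.contDiff_poincareInv (mo 0).1 (mo 0).2).contMDiff.contMDiffAt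
  have hdPr : ∀ x : (B 0).domain, mfderiv 𝓘(ℝ, E4) 𝓘(ℝ, E4) Pr x =
      (((mo 0).1 : E4 ≃L[ℝ] E4).symm : E4 →L[ℝ] E4) := fun x => by
    have h1 : MDifferentiableAt 𝓘(ℝ, E4) 𝓘(ℝ, E4) (fun x : (B 0).domain => P x.1) x := by
      have := (KerrSchildChart.contDiff_poincareInv (mo 0).1 (mo 0).2 (n := ∞)).contMDiff.contMDiffAt (x := x.1)
      exact (contMDiffAt_subtype_iff.2 this).mdifferentiableAt (by simp)
    rw [OpensChart.mfderiv_codRestrict (f := fun x : (B 0).domain => P x.1) (fun _ => rfl) h1]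
    rw [show (fun x : (B 0).domain => P x.1) = P ∘ Subtype.val from rfl,
      mfderiv_comp_subtypeVal (((KerrSchildChart.contDiff_poincareInv (mo 0).1 (mo 0).2 (n := ∞)).contMDiff.contMDiffAt
        (x := x.1)).mdifferentiableAt (by simp)), mfderiv_eq_fderiv, KerrSchildChart.fderiv_poincareInv]
  have hPrinj : Injective Pr := fun x y h =>
    Subtype.ext (poincareInv_injective (mo 0) (congrArg Subtype.val h))
  -- `Pr` as a homeomorphism
  have hlab : ∀ z : Kerr.region (a 0) (M 0), ((mo 0).1 : E4 ≃L[ℝ] E4) z.1 + (mo 0).2 ∈ (B 0).domain := by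
    intro z
    show ((mo 0).1 : E4 ≃L[ℝ] E4) z.1 + (mo 0).2 ∈ ((B 0).domain : Set E4)
    rw [hdom, mem_preimage, show P (((mo 0).1 : E4 ≃L[ℝ] E4) z.1 + (mo 0).2) = z.1 from
      poincareInv_lab (mo 0) z.1]
    exact z.2
  let PrH : (B 0).domain ≃ₜ Kerr.region (a 0) (M 0) :=
    { toFun := Pr
      invFun := fun z => ⟨((mo 0).1 : E4 ≃L[ℝ] E4) z.1 + (mo 0).2, hlab z⟩
      left_inv := fun x => Subtype.ext (lab_poincareInv (mo 0) x.1)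
      right_inv := fun z => Subtype.ext (poincareInv_lab (mo 0) z.1)
      continuous_toFun := hPrs.continuous
      continuous_invFun := by
        refine Continuous.subtype_mk ?_ _
        exact ((((mo 0).1 : E4 ≃L[ℝ] E4).continuous.comp continuous_subtype_val).add continuous_const) }
  /- ### the chart `Ψ` -/
  classical
  set pull : Set (B 0).domain := Pr ⁻¹' lensK (M 0) (a 0) with hpull
  have hpullo : IsOpen pull := (isOpen_lensK (M 0) (a 0)).preimage hPrs.continuous
  let Ψ : (B 0).domain → 𝒱.carrier := fun x => if h : Pr x ∈ lensK (M 0) (a 0) then χ ⟨Pr x, h⟩ else Φ 0 x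
  have hΨ_of : ∀ x (h : Pr x ∈ lensK (M 0) (a 0)), Ψ x = χ ⟨Pr x, h⟩ := fun x h => dif_pos h
  -- the extension of `χ` off the lens, for the calculus
  let χ' : Kerr.region (a 0) (M 0) → 𝒱.carrier := fun z => if h : z ∈ lensK (M 0) (a 0) then χ ⟨z, h⟩ else p
  have hχ'L : (fun z : L => χ' z.1) = χ := funext fun z => dif_pos z.2
  have hχ'at : ∀ z : Kerr.region (a 0) (M 0), z ∈ lensK (M 0) (a 0) →
      ContMDiffAt 𝓘(ℝ, E4) (𝓡 4) ∞ χ' z := fun z hz => by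
    have h : ContMDiffAt 𝓘(ℝ, E4) (𝓡 4) ∞ (fun z : L => χ' z.1) ⟨z, hz⟩ := by rw [hχ'L]; exact hχs ⟨z, hz⟩
    exact contMDiffAt_subtype_iff.1 h
  have hdχ' : ∀ z : L, mfderiv (𝓡 4) (𝓡 4) χ z = mfderiv 𝓘(ℝ, E4) (𝓡 4) χ' z.1 := fun z => by
    rw [← hχ'L]
    exact mfderiv_comp_subtypeVal ((hχ'at z.1 z.2).mdifferentiableAt (by simp))
  have hΨeq : ∀ x ∈ pull, Ψ =ᶠ[𝓝 x] (χ' ∘ Pr) := fun x hx => by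
    filter_upwards [hpullo.mem_nhds hx] with y hy
    rw [hΨ_of y hy]
    have hy' : Pr y ∈ lensK (M 0) (a 0) := hy
    show χ ⟨Pr y, hy⟩ = χ' (Pr y)
    simp only [χ']
    rw [dif_pos hy']
  have hΨat : ∀ x ∈ pull, ContMDiffAt 𝓘(ℝ, E4) (𝓡 4) ∞ Ψ x := fun x hx =>
    ((hχ'at (Pr x) hx).comp x (hPrs x)).congr_of_eventuallyEq (hΨeq x hx)
  have hΨon : ContMDiffOn 𝓘(ℝ, E4) (𝓡 4) ∞ Ψ pull := fun x hx => (hΨat x hx).contMDiffWithinAt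
  have hdΨ : ∀ (x : (B 0).domain) (hx : x ∈ pull) (v : E4), mfderiv 𝓘(ℝ, E4) (𝓡 4) Ψ x v =
      mfderiv 𝓘(ℝ, E4) (𝓡 4) χ' (Pr x) ((((mo 0).1 : E4 ≃L[ℝ] E4).symm : E4 →L[ℝ] E4) v) := by
    intro x hx v
    rw [(hΨeq x hx).mfderiv_eq, mfderiv_comp x ((hχ'at (Pr x) hx).mdifferentiableAt (by simp))
      (hPrs.mdifferentiableAt (by simp)), hdPr x]
    rfl
  -- `χ'` is isometric on the lens (chart form)
  have hisoχ' : ∀ (z : Kerr.region (a 0) (M 0)) (hz : z ∈ lensK (M 0) (a 0)) (u u' : E4),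
      𝒱.metric.val (χ' z) (mfderiv 𝓘(ℝ, E4) (𝓡 4) χ' z u) (mfderiv 𝓘(ℝ, E4) (𝓡 4) χ' z u') =
        Kerr.bilin (M 0) (a 0) z.1 u u' := by
    intro z hz u u'
    have e1 : χ' z = χ ⟨z, hz⟩ := dif_pos hz
    have e2 : mfderiv 𝓘(ℝ, E4) (𝓡 4) χ' z = mfderiv (𝓡 4) (𝓡 4) χ ⟨z, hz⟩ := (hdχ' ⟨z, hz⟩).symm
    have h := congrArg (fun b => b u u') (hχi.2 ⟨z, hz⟩)
    simp only [pullbackBilin_apply] at h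
    rw [e1, e2]
    exact h
  -- exactness of `Ψ` on `pull`
  have hexact : ∀ x ∈ pull, 𝒱.toSpacetime.deviation (B 0) Ψ x = 0 := by
    intro x hx
    ext v w
    have hx' : Pr x ∈ lensK (M 0) (a 0) := hx
    have e1 : χ' (Pr x) = χ ⟨Pr x, hx⟩ := dif_pos hx'
    rw [Spacetime.deviation_apply, hdΨ x hx v, hdΨ x hx w, hΨ_of x hx, ← e1, hisoχ' (Pr x) hx, hbil,
      boostedKerrBilin_apply]
    exact sub_self _
  -- arithmetic: the corrected diamond pulls back into the lens
  have hmem_pull : ∀ x : (B 0).domain, 0 ≤ (B 0).time x.1 →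
      3 * (B 0).time x.1 + 2 * (B 0).radius x.1 < 6 * M 0 → x ∈ pull := by
    intro x h0 h1
    rw [htime] at h0 h1; rw [hrad] at h1
    have hMr : M 0 < Kerr.radius (a 0) (P x.1) := (le_max_left (M 0) 0).trans_lt (hPreg x)
    change 0 ≤ P x.1 0 at h0
    change 3 * P x.1 0 + 2 * Kerr.radius (a 0) (P x.1) < 6 * M 0 at h1
    show (0 < 6 * M 0 - 2 * Kerr.radius (a 0) (P x.1) - 3 * P x.1 0 ∧
      0 < 6 * M 0 - 2 * Kerr.radius (a 0) (P x.1) + 3 * P x.1 0 ∧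
      0 < 2 * P x.1 0 + (Kerr.radius (a 0) (P x.1) - M 0))
    exact ⟨by linarith, by linarith, by linarith⟩
  have hDsub : slabDiamond' (B 0) (M 0) ⊆ pull := fun x hx => hmem_pull x hx.1.le hx.2
  have hDSsub : slabDiamondWithSlab' (B 0) (M 0) ⊆ pull := fun x hx => hmem_pull x hx.1 hx.2
  have hDdia : ∀ x ∈ slabDiamond' (B 0) (M 0), Pr x ∈ diamondK (M 0) (a 0) := by
    intro x hx
    obtain ⟨h0, h1⟩ := hx
    rw [htime] at h0 h1; rw [hrad] at h1
    change 0 < P x.1 0 at h0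
    change 3 * P x.1 0 + 2 * Kerr.radius (a 0) (P x.1) < 6 * M 0 at h1
    exact ⟨h0, by show 0 < 6 * M 0 - 2 * Kerr.radius (a 0) (P x.1) - 3 * P x.1 0; linarith⟩
  -- the slab points of the lens are the images of `Φ₀`
  have hχembed : ∀ y : slabW (M 0) (a 0), χ (𝒦.embed y) = 𝒱.embed (ΦN y) := fun y => congrFun hχe y
  have hslab_eq : ∀ (x : (B 0).domain) (hx : Pr x ∈ lensK (M 0) (a 0)), (B 0).time x.1 = 0 →
      Ψ x = Φ 0 x ∧ Ψ x ∈ Φ 0 '' (B 0).truncTimeSlab (3 * M 0) 0 := by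
    intro x hx ht0
    rw [htime] at ht0
    change P x.1 0 = 0 at ht0
    have hr3 : Kerr.radius (a 0) (P x.1) < 3 * M 0 := by
      have := hx.1; rw [ht0] at this; linarith
    have hmem : (⟨Pr x, hx⟩ : L) ∈ range (𝒮K.embedOpens L hιL) := by
      rw [hrange]; exact ⟨ht0, hr3⟩
    obtain ⟨y, hy⟩ := hmem
    have hval : E4.ofTimeSpace 0 (y : E3) = P x.1 := congrArg (fun z : L => (z.1.1 : E4)) hy
    have hΨy : Ψ x = χ (𝒦.embed y) := by rw [hΨ_of x hx]; exact congrArg χ hy.symm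
    obtain ⟨hxmem, hΦeq⟩ := hιΦ y
    have hpt : (⟨((mo 0).1 : E4 ≃L[ℝ] E4) (E4.ofTimeSpace 0 (y : E3)) + (mo 0).2, hxmem⟩ : (B 0).domain) = x := by
      apply Subtype.ext
      show ((mo 0).1 : E4 ≃L[ℝ] E4) (E4.ofTimeSpace 0 (y : E3)) + (mo 0).2 = x.1
      rw [hval]; exact lab_poincareInv (mo 0) x.1
    have key : Ψ x = Φ 0 x := by rw [hΨy, hχembed y, hΦeq, hpt]
    refine ⟨key, ?_⟩
    rw [key]
    refine ⟨x, ⟨?_, ?_⟩, rfl⟩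
    · rw [htime]; exact ht0
    · rw [hrad]; exact hr3.le
  refine ⟨Ψ, ?_, ?_, hΨon.mono hDsub, ?_, ?_, ?_⟩
  · -- (1) `Ψ = Φ₀` on the closed slab
    intro x hx
    by_cases h : Pr x ∈ lensK (M 0) (a 0)
    · exact (hslab_eq x h hx.1).1
    · exact dif_neg h
  · -- (2) continuity on `Δ' ∪ slab°`
    exact hΨon.continuousOn.mono hDSsub
  · -- (4) open embedding of `Δ'`
    have hsubL : diamondK (M 0) (a 0) ⊆ (L : Set (Kerr.region (a 0) (M 0))) := diamondK_subset_lensK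
    have hincl : IsOpenEmbedding (Set.inclusion hsubL) :=
      IsOpenEmbedding.inclusion hsubL (continuous_subtype_val.isOpen_preimage _ (isOpen_diamondK _ _))
    have hiff : ∀ x : (B 0).domain, x ∈ slabDiamond' (B 0) (M 0) ↔ PrH x ∈ diamondK (M 0) (a 0) := by
      intro x
      refine ⟨fun hx => hDdia x hx, fun hx => ?_⟩
      obtain ⟨h0, h1⟩ := hx
      change 0 < P x.1 0 at h0
      change 0 < 6 * M 0 - 2 * Kerr.radius (a 0) (P x.1) - 3 * P x.1 0 at h1
      refine ⟨?_, ?_⟩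
      · rw [htime]; exact h0
      · rw [htime, hrad]; show 3 * P x.1 0 + 2 * Kerr.radius (a 0) (P x.1) < 6 * M 0; linarith
    let Qd : slabDiamond' (B 0) (M 0) ≃ₜ diamondK (M 0) (a 0) := PrH.subtype hiff
    have hcomp : (slabDiamond' (B 0) (M 0)).restrict Ψ = χ ∘ Set.inclusion hsubL ∘ Qd := by
      funext x
      exact hΨ_of x.1 (hDsub x.2)
    rw [hcomp]
    exact hχo.comp (hincl.comp Qd.isOpenEmbedding)
  · -- (5) placement inside the interior of the Killing domain
    set T : Set L := Subtype.val ⁻¹' diamondK (M 0) (a 0) with hT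
    have hTo : IsOpen T := (isOpen_diamondK _ _).preimage continuous_subtype_val
    have himg : Ψ '' slabDiamond' (B 0) (M 0) ⊆ χ '' T := by
      rintro _ ⟨x, hx, rfl⟩
      exact ⟨⟨Pr x, hDsub hx⟩, hDdia x hx, (hΨ_of x (hDsub hx)).symm⟩
    have hTI : T ⊆ 𝒦.metric.chronologicalFuture 𝒦.timeOrientation (range 𝒦.embed) := by
      show T ⊆ (𝒮K.metric.restrict PseudoRiemannianMetric.contMDiff_restrict_holds L).chronologicalFuture
        (𝒮K.timeOrientation.restrict PseudoRiemannianMetric.contMDiff_restrict_holds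
          𝒮K.timeOrientation.contMDiff_restrict_holds L) (range (𝒮K.embedOpens L hιL))
      rw [hrange]
      exact hI
    have hcore : χ '' range 𝒦.embed ⊆ collarCore M p B Φ := by
      rintro _ ⟨_, ⟨y, rfl⟩, rfl⟩
      rw [hχembed y]
      obtain ⟨hxmem, hΦeq⟩ := hιΦ y
      rw [hΦeq]
      refine image_truncTimeSlab_subset_collarCore M p B Φ 0 ⟨_, ⟨?_, ?_⟩, rfl⟩
      · rw [htime]
        show poincareInv (mo 0).1 (mo 0).2 (((mo 0).1 : E4 ≃L[ℝ] E4) (E4.ofTimeSpace 0 (y : E3)) + (mo 0).2) 0 = 0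
        rw [poincareInv_lab]; rfl
      · rw [hrad]
        show Kerr.radius (a 0) (poincareInv (mo 0).1 (mo 0).2
          (((mo 0).1 : E4 ≃L[ℝ] E4) (E4.ofTimeSpace 0 (y : E3)) + (mo 0).2)) ≤ 3 * M 0
        rw [poincareInv_lab]; exact y.2.le
    have hsub : χ '' T ⊆ killingDomain 𝒱 M p B Φ :=
      ((image_mono hTI).trans hplace).trans
        ((futureDomain_mono _ hcore).trans (futureDomain_mono _ subset_union_left))
    exact himg.trans (interior_maximal hsub (hχo.isOpenMap _ hTo))
  · -- (6) exactness on `Δ'`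
    refine supCkENorm_zero_le_of_forall_eq_zero ?_
    rintro _ ⟨x, hx, rfl⟩
    rw [Spacetime.deviationExtend_coe]
    exact hexact x (hDsub hx)

end F1Route

open Literature.Geometry.Lorentzian F1Route in
/-- **F1' (corrected slab-jet Cauchy rigidity), proved modulo the MGHD existence fact** — the
registered stub `stub_slabCauchyRigidity'` of line `direct-method-on-the-cone`:
`choquetBruhat_geroch_exists_mghd_cauchy → F1Route.SlabCauchyRigidity'`, by the checked reduction
from (A) `slabSubdatum_holds`, (C) `kerrSlabLensCauchy_holds`, (D)
`subdataDevelopmentsEmbedLit_of_choquetBruhatGeroch` (the only use of the fact) and (E)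
`subdevelopmentFuturePlacement_holds`. [cite: ChoquetBruhatGeroch1969CMP, Thm. 3] -/
theorem stub_slabCauchyRigidity' : choquetBruhat_geroch_exists_mghd_cauchy → F1Route.SlabCauchyRigidity' :=
  fun hcbg => slabCauchyRigidity'_of_route slabSubdatum_holds kerrSlabLensCauchy_holds
    (subdataDevelopmentsEmbedLit_of_choquetBruhatGeroch hcbg) subdevelopmentFuturePlacement_holds

end Summit.FinalStateConjecture.FinalStateConjecture.Theorems.BondiBartnikRigidity.DirectMethod

end
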